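import Summits.KontsevichZagierPeriods.KontsevichZagierPeriods.Theorems.TerasomaMultiplicationMultiplicationAccessibleCornerFieldGen
import Summits.KontsevichZagierPeriods.KontsevichZagierPeriods.Theorems.TerasomaMultiplicationMultiplicationAccessibleCornerGraphSpellingGen

/-!
# `MultiplicationAccessible` (stmt-KontsevichZagierPeriods-12305), line `shifted-family-prime-sieve`:
identification of the spelled Stokes components with the structural ones, dimension `p = n + 2`

On the corner blow-up chart domain `U` (coordinates `u = (θ₁, …, θ_{n+1}, y)`, `θ₀ = 1 − Σθ_i`,
box coordinates `t_k = T u k = 1 − yΘ_k ∈ (0,1)`, `Z = (∏ t_k)^(1/p) ∈ (0,1)`, `H·(1 − Z) = y`,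
`K = (∏Θ_k)^(s−1)`, `M u k = t_k^x ∏_j t_{k+j+1}^(x+(j+1)/p−1)`) the Liouville flux field
`Y_k(t) = (1/p)(1 − t_k)(1 − ζ)^(−ps)·∏(1 − t_i)^(s−1)·M_k·ζ^(−px)` pulled back along `t = T u` reads
`Y_k(T u) = c(u)·Θ_k·M u k` with the scalar
`c = (1/p)·y·(1 − Z)^(−ps)·(y^(ps)/y^p)·K·Z^(−px)` (`CornerIdent.Yt_chart`). Together with the
cyclic relation `Z·Σ_k M u k/T u k = Σ_k M u k` (`CornerIdent.sigma_rel`, from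
`CornerField.sum_rho_mul_sub`) this identifies the three spelled components `V_y`, `V_θᵢ`, `V_v` of
the corner Stokes form with the structural ones (`cornerIdentGen`, identities E1–E3): pure `rpow`
book-keeping.
References: Kontsevich–Zagier 2001 §1.2 (Stokes moves); Andrews–Askey–Roy 1999 Thm 1.5.2.
-/

noncomputable section

open Real Finset
open scoped BigOperators

namespace Summit.KontsevichZagierPeriods.TerasomaMultiplication.MultiplicationAccessible

namespace CornerIdent

variable {n : ℕ}

/-- `M u k / T u k = (∏_i t_i)^(x−1)·ρ_k` with `ρ_k = ∏_j t_{k+j+1}^((j+1)/p)`, for positive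
`t = T u` (split each exponent `x + (j+1)/p − 1 = (x − 1) + (j+1)/p`). [folklore] -/
theorem M_div_T_rho (x : ℚ) {T M : (Fin (n + 2) → ℝ) → Fin (n + 2) → ℝ}
    (hM : ∀ u k, M u k = (T u k) ^ (x:ℝ) *
      ∏ j : Fin (n + 1), (T u (k + j.succ)) ^ ((x:ℝ) + (((j:ℕ):ℝ) + 1) / ((n:ℝ) + 2) - 1))
    {u : Fin (n + 2) → ℝ} (ht : ∀ k, 0 < T u k) (k : Fin (n + 2)) :
    M u k / T u k = (∏ i, T u i) ^ ((x:ℝ) - 1) *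
      ∏ j : Fin (n + 1), T u (k + j.succ) ^ ((((j:ℕ):ℝ) + 1) / ((n:ℝ) + 2)) := by
  rw [CornerGraphGen.M_div_T x hM (ht k).ne', ← Real.finsetProd_rpow _ _ (fun i _ => (ht i).le),
    ← CornerField.mul_prod_add_succ (fun i => T u i ^ ((x:ℝ) - 1)) k, mul_assoc,
    ← Finset.prod_mul_distrib]
  congr 1
  refine Finset.prod_congr rfl fun j _ => ?_
  rw [← Real.rpow_add (ht _)]
  congr 1
  ring

/-- **The cyclic relation** `Z u · Σ_k M u k / T u k = Σ_k M u k` for positive `t = T u`: with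
`M_k/T_k = (∏t)^(x−1)·ρ_k` and `M_k = (∏t)^(x−1)·ρ_k·t_k` it is `Σ_k ρ_k (ζ − t_k) = 0`
(`CornerField.sum_rho_mul_sub`). [folklore] -/
theorem sigma_rel (x : ℚ) {T M : (Fin (n + 2) → ℝ) → Fin (n + 2) → ℝ} {Z : (Fin (n + 2) → ℝ) → ℝ}
    (hZ : ∀ u, Z u = (∏ k, T u k) ^ (1 / ((n:ℝ) + 2)))
    (hM : ∀ u k, M u k = (T u k) ^ (x:ℝ) *
      ∏ j : Fin (n + 1), (T u (k + j.succ)) ^ ((x:ℝ) + (((j:ℕ):ℝ) + 1) / ((n:ℝ) + 2) - 1))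
    {u : Fin (n + 2) → ℝ} (ht : ∀ k, 0 < T u k) :
    Z u * ∑ k, M u k / T u k = ∑ k, M u k := by
  rw [← sub_eq_zero, Finset.mul_sum, ← Finset.sum_sub_distrib]
  calc ∑ k, (Z u * (M u k / T u k) - M u k)
      = (∏ i, T u i) ^ ((x:ℝ) - 1) * ∑ k : Fin (n + 2),
          (∏ j : Fin (n + 1), T u (k + j.succ) ^ ((((j:ℕ):ℝ) + 1) / ((n:ℝ) + 2))) *
            ((∏ i, T u i) ^ (1 / ((n:ℝ) + 2)) - T u k) := by
        rw [Finset.mul_sum]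
        refine Finset.sum_congr rfl fun k _ => ?_
        have hρ := M_div_T_rho x hM ht k
        have hMk : M u k = (∏ i, T u i) ^ ((x:ℝ) - 1) *
            (∏ j : Fin (n + 1), T u (k + j.succ) ^ ((((j:ℕ):ℝ) + 1) / ((n:ℝ) + 2))) * T u k := by
          rw [← hρ, div_mul_cancel₀ _ (ht k).ne']
        rw [hρ, hMk, hZ]
        ring
    _ = 0 := by rw [CornerField.sum_rho_mul_sub (T u) ht, mul_zero]

/-- `1/y · Σ… book-keeping`: `y·Σ_k Θ_k M_k/T_k = (1 − Z)·Σ_k M_k/T_k` on the chart, since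
`yΘ_k = 1 − t_k` and `Z·ΣM_k/t_k = ΣM_k` (`sigma_rel`). [folklore] -/
theorem y_mul_sum_div (x : ℚ) {Θ T M : (Fin (n + 2) → ℝ) → Fin (n + 2) → ℝ}
    {Z : (Fin (n + 2) → ℝ) → ℝ}
    (hT : ∀ u k, T u k = 1 - u (Fin.last (n + 1)) * Θ u k)
    (hZ : ∀ u, Z u = (∏ k, T u k) ^ (1 / ((n:ℝ) + 2)))
    (hM : ∀ u k, M u k = (T u k) ^ (x:ℝ) *
      ∏ j : Fin (n + 1), (T u (k + j.succ)) ^ ((x:ℝ) + (((j:ℕ):ℝ) + 1) / ((n:ℝ) + 2) - 1))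
    {u : Fin (n + 2) → ℝ} (ht : ∀ k, 0 < T u k) :
    u (Fin.last (n + 1)) * ∑ k, Θ u k * M u k / T u k = (1 - Z u) * ∑ k, M u k / T u k := by
  rw [sub_mul, one_mul, sigma_rel x hZ hM ht, Finset.mul_sum, ← Finset.sum_sub_distrib]
  refine Finset.sum_congr rfl fun k _ => ?_
  have hk : T u k ≠ 0 := (ht k).ne'
  have h1 : u (Fin.last (n + 1)) * Θ u k = 1 - T u k := by rw [hT]; ring
  calc u (Fin.last (n + 1)) * (Θ u k * M u k / T u k) = (1 - T u k) * M u k / T u k := by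
        rw [← h1]; ring
    _ = M u k / T u k - M u k := by field_simp

/-- `Σ_j Θ_j·(a − M_j) = a − Σ_j Θ_j M_j`, as the barycentric weights sum to one. [folklore] -/
theorem sum_theta_mul_sub {Θ M : (Fin (n + 2) → ℝ) → Fin (n + 2) → ℝ}
    (hΘ0 : ∀ u, Θ u 0 = 1 - ∑ i : Fin (n + 1), u (Fin.castSucc i))
    (hΘs : ∀ u (i : Fin (n + 1)), Θ u i.succ = u (Fin.castSucc i)) (u : Fin (n + 2) → ℝ) (a : ℝ) :
    ∑ j, Θ u j * (a - M u j) = a - ∑ j, Θ u j * M u j := by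
  simp only [mul_sub]
  rw [Finset.sum_sub_distrib, ← Finset.sum_mul, CornerGraphGen.sum_theta hΘ0 hΘs, one_mul]

/-- Power book-keeping in `y > 0`: `(y^(s−1))^(n+2) = y^((n+2)s)/y^(n+2)`. [folklore] -/
theorem rpow_sub_one_pow_eq {y : ℝ} (hy : 0 < y) (s : ℝ) (n : ℕ) :
    (y ^ (s - 1)) ^ (n + 2) = y ^ (((n:ℝ) + 2) * s) / y ^ (n + 2) := by
  rw [← rpow_natCast (y ^ (s - 1)) (n + 2), ← rpow_mul hy.le, eq_div_iff (pow_pos hy _).ne',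
    ← rpow_natCast y (n + 2), ← rpow_add hy]
  congr 1
  push_cast
  ring

/-- **The flux field on the chart**: with `t = T u` (`u ∈ U`),
`Y_k(T u) = (1/p)·y·(1 − Z)^(−ps)·(y^(ps)/y^(n+2)·K)·Z^(−px) · (Θ_k·M u k)`
(`1 − t_k = yΘ_k`, `∏(1 − t_i)^(s−1) = (y^(s−1))^p·K`, `(∏t)^(1/p) = Z`).
[cite: KontsevichZagier2001, §1.2] -/
theorem Yt_chart (x s : ℚ) {Θ T M : (Fin (n + 2) → ℝ) → Fin (n + 2) → ℝ}
    {Z K : (Fin (n + 2) → ℝ) → ℝ} {Yt : (Fin (n + 2) → ℝ) → Fin (n + 2) → ℝ}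
    (hT : ∀ u k, T u k = 1 - u (Fin.last (n + 1)) * Θ u k)
    (hZ : ∀ u, Z u = (∏ k, T u k) ^ (1 / ((n:ℝ) + 2)))
    (hK : ∀ u, K u = (∏ k, Θ u k) ^ ((s:ℝ) - 1))
    (hM : ∀ u k, M u k = (T u k) ^ (x:ℝ) *
      ∏ j : Fin (n + 1), (T u (k + j.succ)) ^ ((x:ℝ) + (((j:ℕ):ℝ) + 1) / ((n:ℝ) + 2) - 1))
    (hYt : ∀ t k, Yt t k = 1 / ((n:ℝ) + 2) * (1 - t k) *
      (1 - (∏ i, t i) ^ (1 / ((n:ℝ) + 2))) ^ (-(((n:ℝ) + 2) * (s:ℝ))) *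
      (∏ i, (1 - t i) ^ ((s:ℝ) - 1)) *
      ((t k) ^ (x:ℝ) * ∏ j : Fin (n + 1), (t (k + j.succ)) ^ ((x:ℝ) + (((j:ℕ):ℝ) + 1) / ((n:ℝ) + 2) - 1)) *
      ((∏ i, t i) ^ (1 / ((n:ℝ) + 2))) ^ (-(((n:ℝ) + 2) * (x:ℝ))))
    {u : Fin (n + 2) → ℝ} (hy : 0 < u (Fin.last (n + 1))) (hΘ : ∀ k, 0 ≤ Θ u k) (hZ1 : Z u < 1)
    (hZ0 : 0 ≤ Z u) (k : Fin (n + 2)) :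
    Yt (T u) k = (1 / ((n:ℝ) + 2) * u (Fin.last (n + 1)) *
        ((1 - Z u) ^ (((n:ℝ) + 2) * (s:ℝ)))⁻¹ *
        (u (Fin.last (n + 1)) ^ (((n:ℝ) + 2) * (s:ℝ)) / u (Fin.last (n + 1)) ^ (n + 2) * K u) *
        (Z u ^ (((n:ℝ) + 2) * (x:ℝ)))⁻¹) * (Θ u k * M u k) := by
  rw [hYt, ← hZ, ← hM, CornerGraphGen.prod_one_sub_T_rpow _ hT hy.le hΘ, ← hK,
    rpow_sub_one_pow_eq hy, rpow_neg (sub_nonneg.2 hZ1.le), rpow_neg hZ0, hT u k, sub_sub_cancel]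
  ring

end CornerIdent

/-- **Identification of the spelled corner Stokes components with the structural ones,
dimension `p = n + 2`** (registered stub `cornerIdentGen`): on the chart domain `U`, with the
Liouville flux field `Y` pulled back along `t = T u`, the `y`-component (E1), the `θᵢ`-components
(E2) and the `v`-component (E3) of the spelled form agree with the structural expressions in
`Σ_k Y_k(T u)`, `Y_{i+1}(T u) − θᵢ Σ_k Y_k(T u)` and `Σ_k Y_k(T u)/T u k`. Pure `rpow` book-keeping
(`CornerIdent.Yt_chart`, `H·(1 − Z) = y`, `Σ_k Θ_k = 1`) and the cyclic relation
`Z·Σ_k M_k/t_k = Σ_k M_k` (`CornerIdent.sigma_rel`). [cite: KontsevichZagier2001, §1.2] -/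
theorem cornerIdentGen : ∀ (n : ℕ) (x s : ℚ), 0 < x → 0 < s → ∀ (Θ T : (Fin (n + 2) → ℝ) → Fin (n + 2) → ℝ) (Z S H K : (Fin (n + 2) → ℝ) → ℝ)
      (M : (Fin (n + 2) → ℝ) → Fin (n + 2) → ℝ) (P : (Fin (n + 3) → ℝ) → ℝ),
    (∀ u, Θ u 0 = 1 - ∑ i : Fin (n + 1), u (Fin.castSucc i)) → (∀ u (i : Fin (n + 1)), Θ u i.succ = u (Fin.castSucc i)) →
    (∀ u k, T u k = 1 - u (Fin.last (n + 1)) * Θ u k) →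
    (∀ u, Z u = (∏ k, T u k) ^ (1 / ((n:ℝ) + 2))) →
    (∀ u, S u = ∑ j ∈ Finset.range (n + 2), (-1:ℝ) ^ j * u (Fin.last (n + 1)) ^ j *
      ∑ A ∈ Finset.powersetCard (j + 1) (Finset.univ : Finset (Fin (n + 2))), ∏ k ∈ A, Θ u k) →
    (∀ u, H u = (∑ j ∈ Finset.range (n + 2), Z u ^ j) / S u) →
    (∀ u, K u = (∏ k, Θ u k) ^ ((s:ℝ) - 1)) →
    (∀ u k, M u k = (T u k) ^ (x:ℝ) * ∏ j : Fin (n + 1), (T u (k + j.succ)) ^ ((x:ℝ) + (((j:ℕ):ℝ) + 1) / ((n:ℝ) + 2) - 1)) →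
    (∀ w, P w = (w (Fin.last (n + 2))) ^ (((n:ℝ) + 2) * (x:ℝ) - 1) *
      (1 - w (Fin.last (n + 2)) * Z (Fin.init w)) ^ (((n:ℝ) + 2) * (s:ℝ) - 1) * H (Fin.init w) ^ (((n:ℝ) + 2) * (s:ℝ)) * K (Fin.init w)) →
    ∀ (Yt : (Fin (n + 2) → ℝ) → Fin (n + 2) → ℝ), (∀ t k, Yt t k = 1 / ((n:ℝ) + 2) * (1 - t k) * (1 - (∏ i, t i) ^ (1 / ((n:ℝ) + 2))) ^ (-(((n:ℝ) + 2) * (s:ℝ))) *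
      (∏ i, (1 - t i) ^ ((s:ℝ) - 1)) *
      ((t k) ^ (x:ℝ) * ∏ j : Fin (n + 1), (t (k + j.succ)) ^ ((x:ℝ) + (((j:ℕ):ℝ) + 1) / ((n:ℝ) + 2) - 1)) *
      ((∏ i, t i) ^ (1 / ((n:ℝ) + 2))) ^ (-(((n:ℝ) + 2) * (x:ℝ)))) →
    ∀ u ∈ {u : Fin (n + 2) → ℝ | (∀ i : Fin (n + 1), 0 < u (Fin.castSucc i)) ∧ ∑ i : Fin (n + 1), u (Fin.castSucc i) < 1 ∧ 0 < u (Fin.last (n + 1)) ∧ u (Fin.last (n + 1)) * (1 - ∑ i : Fin (n + 1), u (Fin.castSucc i)) < 1 ∧ ∀ i : Fin (n + 1), u (Fin.last (n + 1)) * u (Fin.castSucc i) < 1},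
      (∀ v : ℝ, 0 < v →
        (v ^ (((n:ℝ) + 2) * (x:ℝ) - 1) * (1 - v * Z u) ^ (((n:ℝ) + 2) * (s:ℝ) - 1) * H u ^ (((n:ℝ) + 2) * (s:ℝ)) * K u) *
          ∑ k, Θ u k * M u k =
        (((n:ℝ) + 2) * (v * Z u) ^ (((n:ℝ) + 2) * (x:ℝ) - 1) * (1 - v * Z u) ^ (((n:ℝ) + 2) * (s:ℝ) - 1)) * Z u *
          ((u (Fin.last (n + 1))) ^ (n + 1) * ∑ k, Yt (T u) k)) ∧
      (∀ v : ℝ, 0 < v → ∀ i : Fin (n + 1),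
        (v ^ (((n:ℝ) + 2) * (x:ℝ) - 1) * (1 - v * Z u) ^ (((n:ℝ) + 2) * (s:ℝ) - 1) * H u ^ (((n:ℝ) + 2) * (s:ℝ)) * K u) *
          u (Fin.castSucc i) * (∑ j, Θ u j * (M u i.succ - M u j)) / u (Fin.last (n + 1)) =
        (((n:ℝ) + 2) * (v * Z u) ^ (((n:ℝ) + 2) * (x:ℝ) - 1) * (1 - v * Z u) ^ (((n:ℝ) + 2) * (s:ℝ) - 1)) * Z u *
          ((u (Fin.last (n + 1))) ^ n * (Yt (T u) i.succ - u (Fin.castSucc i) * ∑ k, Yt (T u) k))) ∧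
      (∀ b : ℝ, 0 < b →
        -(1 / ((n:ℝ) + 2) * b ^ (((n:ℝ) + 2) * (x:ℝ)) * (1 - b * Z u) ^ (((n:ℝ) + 2) * (s:ℝ) - 1) * H u ^ (((n:ℝ) + 2) * (s:ℝ) - 1) *
          K u * ∑ k, M u k / T u k) =
        (((n:ℝ) + 2) * (b * Z u) ^ (((n:ℝ) + 2) * (x:ℝ) - 1) * (1 - b * Z u) ^ (((n:ℝ) + 2) * (s:ℝ) - 1)) * b *
          (-(Z u * (u (Fin.last (n + 1))) ^ (n + 1) / ((n:ℝ) + 2)) * ∑ k, Yt (T u) k / T u k)) := by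
  intro n x s _ _ Θ T Z S H K M P hΘ0 hΘs hT hZ hS hH hK hM _ Yt hYt u hu
  obtain ⟨-, ⟨hZ0, hZ1⟩, -, hHy⟩ := CornerGraphGen.S_pos_H hΘ0 hΘs hT hZ hS hH hu
  have hmem := CornerGraphGen.T_mem hΘ0 hΘs hT hu
  have ht : ∀ k, 0 < T u k := fun k => (hmem k).2.1
  have hΘ : ∀ k, 0 ≤ Θ u k := fun k => (hmem k).1.1.le
  have hy : 0 < u (Fin.last (n + 1)) := hu.2.2.1
  have hp : (0:ℝ) < (n:ℝ) + 2 := by positivity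
  have hp' : (n:ℝ) + 2 ≠ 0 := hp.ne'
  have h1Z : 0 < 1 - Z u := sub_pos.2 hZ1
  have hHeq : H u = u (Fin.last (n + 1)) / (1 - Z u) := (eq_div_iff h1Z.ne').2 hHy
  have hHps : H u ^ (((n:ℝ) + 2) * (s:ℝ)) =
      u (Fin.last (n + 1)) ^ (((n:ℝ) + 2) * (s:ℝ)) / (1 - Z u) ^ (((n:ℝ) + 2) * (s:ℝ)) := by
    rw [hHeq, div_rpow hy.le h1Z.le]
  have hHne : H u ≠ 0 := by rw [hHeq]; positivity
  have hW : (1 - Z u) ^ (((n:ℝ) + 2) * (s:ℝ)) ≠ 0 := (rpow_pos_of_pos h1Z _).ne'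
  have hZp : Z u ^ (((n:ℝ) + 2) * (x:ℝ)) ≠ 0 := (rpow_pos_of_pos hZ0 _).ne'
  have hZne : Z u ≠ 0 := hZ0.ne'
  have h1Zne : 1 - Z u ≠ 0 := h1Z.ne'
  have hyne : u (Fin.last (n + 1)) ≠ 0 := hy.ne'
  have hYt' := CornerIdent.Yt_chart x s hT hZ hK hM hYt hy hΘ hZ1 hZ0.le
  refine ⟨fun v hv => ?_, fun v hv i => ?_, fun b hb => ?_⟩
  · simp only [hYt']
    rw [← Finset.mul_sum, mul_rpow hv.le hZ0.le, rpow_sub_one hZne, hHps]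
    field_simp
    ring
  · rw [CornerIdent.sum_theta_mul_sub hΘ0 hΘs]
    simp only [hYt']
    rw [← Finset.mul_sum, hΘs u i, mul_rpow hv.le hZ0.le, rpow_sub_one hZne, hHps]
    field_simp
    ring
  · have hYt'' : ∀ k, Yt (T u) k / T u k = (1 / ((n:ℝ) + 2) * u (Fin.last (n + 1)) *
        ((1 - Z u) ^ (((n:ℝ) + 2) * (s:ℝ)))⁻¹ *
        (u (Fin.last (n + 1)) ^ (((n:ℝ) + 2) * (s:ℝ)) / u (Fin.last (n + 1)) ^ (n + 2) * K u) *
        (Z u ^ (((n:ℝ) + 2) * (x:ℝ)))⁻¹) * (Θ u k * M u k / T u k) := fun k => by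
      rw [hYt', mul_div_assoc]
    have hSA : ∑ k, Θ u k * M u k / T u k =
        (1 - Z u) * (∑ k, M u k / T u k) / u (Fin.last (n + 1)) := by
      rw [eq_div_iff hyne, mul_comm, CornerIdent.y_mul_sum_div x hT hZ hM ht]
    simp only [hYt'']
    rw [← Finset.mul_sum, hSA, mul_rpow hb.le hZ0.le, rpow_sub_one hZne, rpow_sub_one hb.ne',
      rpow_sub_one hHne, hHps, hHeq]
    field_simp
    ring

end Summit.KontsevichZagierPeriods.TerasomaMultiplication.MultiplicationAccessible

end
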